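import Mathlib.NumberTheory.LSeries.Convolution
import Literature.NumberTheory.ModularForms.CohenEisensteinCoefficients
import HarnessLib

set_option autoImplicit false

/-!
# Crux `PrintCFram.BottomClassIndexLawFiveLe` (stmt-BirchSwinnertonDyer-20372), line `eisenstein-resource-bdp-line` (registry v24):
# (E1) OF THE CUSP-CONJUNCT ASSEMBLY — LEMMA B «THE `f`-SUM»: THE DIRICHLET SERIES OF COHEN'S DIVISOR SUM `T_r(D, ·)`
# OVER THE INTEGERS PRIME TO `M` (cell `bsd-print-cfram`, width seat `bsd-line-cfram-p1-w5` g6; THEOREMS ONLY,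
# `--supports` 20372; BSD is not proved by any of this)

HONEST FRAMING. Elementary multiplicative number theory about the integer sequence `T_r(D, f) = Σ_{d ∣ f} μ(d) χ_D(d) d^{r−1}
σ_{2r−1}(f/d)` of w4 g12's `CohenEisenstein.cohenT` (the second factor of Cohen's `H(r, D f²) = L(1−r, χ_D)·T_r(D, f)`,
[Cohen1975, §2]). Ingredient (E1) = «Lemma B» of the proof plan for the cusp conjunct of the registered stub `stub_cuspCutForm`
(crux notes `Lines/eisenstein-resource-bdp-line-w5g5-cusp-seed.md` §3, §5, §15): in the Rankin unfolding of
`L(F_e, s) = Σ_{n'} H(k, m n') n'^{−s}` along `n' = N f²` the inner sum over `f ⊥ 6m` is this Dirichlet series.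

* `chiDisc_mul_right` — `χ_D` is completely multiplicative; `convolution_ite_coprime` — restriction to `{n ⊥ M}` commutes with
  Dirichlet convolution (Mathlib `LSeries.convolution`, `⍟`);
* `cohenT_eq_convolution` — `T_r(D,·) = (μ χ_D id^{r−1}) ⋆ σ_{2r−1}`; `ite_coprime_cohenT_eq_convolution` —
  `𝟙_{⊥M} T = (𝟙_{⊥M} μ χ_D id^{r−1}) ⋆ (𝟙_{⊥M} ⋆ 𝟙_{⊥M} id^{2r−1})`;
* summability in `Re s > 2r` of all the series involved (`LSeriesSummable_ite_coprime_cohenT`, …);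
* **`LSeries_ite_coprime_cohenT`** (LEMMA B): for `r ≥ 1`, `Re s > 2r`,
  `Σ_{f ⊥ M} T_r(D,f) f^{−s} = (Σ_{d ⊥ M} μ(d) χ_D(d) d^{r−1−s}) · ζ^{(M)}(s) · ζ^{(M)}(s − 2r + 1)`, all factors written as raw
  `LSeries` of explicit sequences (`ζ^{(M)}(s) = L(𝟙_{⊥M}, s)`, `ζ^{(M)}(s−2r+1) = L(𝟙_{⊥M} id^{2r−1}, s)`; the first factor is
  `1/L^{(M)}(s − r + 1, χ_D)`, kept as a convergent series so that no non-vanishing is needed).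

Deliberately NOT here: the identification of these raw series with Mathlib's `riemannZeta` / `DirichletCharacter.LFunction`
(only needed at the very end of (E3)), and anything about modular forms. [folklore] beyond the definition of `T_r`.

References: [Cohen1975] H. Cohen, Math. Ann. 217 (1975), §2; Mathlib `Mathlib.NumberTheory.LSeries.Convolution`.
-/

-- summit-side namespace `Summit.BirchSwinnertonDyer.BirchSwinnertonDyer.…` (single-conjunct summit, D-0017 layout)
set_option linter.dupNamespace false

namespace Summit.BirchSwinnertonDyer.BirchSwinnertonDyer.Theorems.PrintCFram.CuspSeed

open LSeries ArithmeticFunction Literature.NumberTheory.ModularForms.CohenEisenstein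
open scoped LSeries.notation ArithmeticFunction.Moebius ArithmeticFunction.sigma

/-! ## §1 `χ_D` is completely multiplicative -/

/-- The Kronecker symbol `χ_D` of w4 g12's `CohenEisenstein.chiDisc` is completely multiplicative in its argument
(Jacobi symbol multiplicativity; the parity clause for `D ≢ 1 (mod 4)`). [folklore] -/
theorem chiDisc_mul_right (D : ℤ) (a b : ℕ) : chiDisc D (a * b) = chiDisc D a * chiDisc D b := by
  by_cases hD : D % 4 = 1
  · simp only [chiDisc_of_emod_four_eq_one hD, Nat.cast_mul, jacobiSym.mul_left]
  · rcases Nat.even_or_odd a with ha | ha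
    · rw [chiDisc_of_emod_four_ne_one_of_even hD ha, chiDisc_of_emod_four_ne_one_of_even hD (ha.mul_right b),
        zero_mul]
    rcases Nat.even_or_odd b with hb | hb
    · rw [chiDisc_of_emod_four_ne_one_of_even hD hb, chiDisc_of_emod_four_ne_one_of_even hD (hb.mul_left a),
        mul_zero]
    rw [chiDisc_of_emod_four_ne_one_of_odd hD ha, chiDisc_of_emod_four_ne_one_of_odd hD hb,
      chiDisc_of_emod_four_ne_one_of_odd hD (ha.mul hb), jacobiSym.mul_right' D ha.pos.ne' hb.pos.ne']

/-! ## §2 Restriction to integers prime to `M` commutes with Dirichlet convolution -/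

/-- For sequences `f g : ℕ → ℂ` and `M : ℕ`: restricting both to the integers prime to `M` and convolving is the same as
convolving and then restricting (`(a,b) ↦ ab` preserves and reflects coprimality with `M`). [folklore] -/
theorem convolution_ite_coprime (M : ℕ) (f g : ℕ → ℂ) :
    (fun a : ℕ ↦ if a.Coprime M then f a else 0) ⍟ (fun b : ℕ ↦ if b.Coprime M then g b else 0) =
      fun n : ℕ ↦ if n.Coprime M then (f ⍟ g) n else 0 := by
  funext n
  rw [convolution_def, convolution_def]
  simp only
  split_ifs with hn
  · refine Finset.sum_congr rfl fun p hp ↦ ?_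
    obtain ⟨hpn, -⟩ := Nat.mem_divisorsAntidiagonal.1 hp
    have ha : p.1.Coprime M := Nat.Coprime.coprime_dvd_left ⟨p.2, hpn.symm⟩ hn
    have hb : p.2.Coprime M := Nat.Coprime.coprime_dvd_left ⟨p.1, by rw [mul_comm]; exact hpn.symm⟩ hn
    rw [if_pos ha, if_pos hb]
  · refine Finset.sum_eq_zero fun p hp ↦ ?_
    obtain ⟨hpn, -⟩ := Nat.mem_divisorsAntidiagonal.1 hp
    by_cases ha : p.1.Coprime M
    · by_cases hb : p.2.Coprime M
      · exact absurd (hpn ▸ Nat.Coprime.mul_left ha hb) hn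
      · rw [if_neg hb, mul_zero]
    · rw [if_neg ha, zero_mul]

/-! ## §3 Cohen's `T_r(D, ·)` as a Dirichlet convolution -/

/-- `σ_k = 𝟙 ⋆ id^k` as sequences `ℕ → ℂ`. [folklore] -/
theorem sigma_eq_convolution (k : ℕ) :
    (fun e : ℕ ↦ ((σ k e : ℕ) : ℂ)) = (fun _ : ℕ ↦ (1 : ℂ)) ⍟ (fun b : ℕ ↦ (b : ℂ) ^ k) := by
  funext n
  rw [convolution_def]
  simp only [one_mul, sigma_apply, Nat.cast_sum, Nat.cast_pow]
  exact (Nat.sum_divisorsAntidiagonal' (f := fun _ b ↦ ((b : ℂ)) ^ k) (n := n)).symm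

/-- **Cohen's divisor sum is a Dirichlet convolution:** `T_r(D, ·) = (μ · χ_D · id^{r−1}) ⋆ σ_{2r−1}` as sequences `ℕ → ℂ`
(this is the definition `T_r(D,f) = Σ_{d ∣ f} μ(d) χ_D(d) d^{r−1} σ_{2r−1}(f/d)` of `CohenEisenstein.cohenT` read on the divisor
antidiagonal). [cite: Cohen1975, §2 (definition of H(r, N))] -/
theorem cohenT_eq_convolution (r : ℕ) (D : ℤ) :
    (fun f : ℕ ↦ (cohenT r D f : ℂ)) =
      (fun d : ℕ ↦ (μ d : ℂ) * (chiDisc D d : ℂ) * (d : ℂ) ^ (r - 1)) ⍟ (fun e : ℕ ↦ ((σ (2 * r - 1) e : ℕ) : ℂ)) := by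
  funext f
  rw [convolution_def]
  simp only [cohenT, Int.cast_sum, Int.cast_mul, Int.cast_pow, Int.cast_natCast]
  exact (Nat.sum_divisorsAntidiagonal (n := f)
    (f := fun d e ↦ (μ d : ℂ) * (chiDisc D d : ℂ) * (d : ℂ) ^ (r - 1) * ((σ (2 * r - 1) e : ℕ) : ℂ))).symm

/-- **`𝟙_{⊥M} · T_r(D, ·)` as a triple convolution of `M`-coprime sequences:**
`𝟙_{⊥M} T_r(D,·) = (𝟙_{⊥M} μ χ_D id^{r−1}) ⋆ ((𝟙_{⊥M}) ⋆ (𝟙_{⊥M} id^{2r−1}))`. [cite: Cohen1975, §2 (definition of H(r, N))] -/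
theorem ite_coprime_cohenT_eq_convolution (r : ℕ) (D : ℤ) (M : ℕ) :
    (fun f : ℕ ↦ if f.Coprime M then (cohenT r D f : ℂ) else 0) =
      (fun d : ℕ ↦ if d.Coprime M then (μ d : ℂ) * (chiDisc D d : ℂ) * (d : ℂ) ^ (r - 1) else 0) ⍟
        ((fun a : ℕ ↦ if a.Coprime M then (1 : ℂ) else 0) ⍟ (fun b : ℕ ↦ if b.Coprime M then (b : ℂ) ^ (2 * r - 1) else 0)) := by
  rw [convolution_ite_coprime M (fun _ ↦ (1 : ℂ)) (fun b ↦ (b : ℂ) ^ (2 * r - 1)), ← sigma_eq_convolution,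
    convolution_ite_coprime M, ← cohenT_eq_convolution]

/-! ## §4 Summability -/

/-- `L(𝟙_{⊥M}, s)` converges absolutely for `Re s > 1`. [folklore] -/
theorem LSeriesSummable_ite_coprime_one (M : ℕ) {s : ℂ} (hs : 1 < s.re) :
    LSeriesSummable (fun a : ℕ ↦ if a.Coprime M then (1 : ℂ) else 0) s := by
  refine LSeriesSummable_of_le_const_mul_rpow hs ⟨1, fun n _ ↦ ?_⟩
  rw [sub_self, Real.rpow_zero, mul_one]
  split_ifs <;> simp

/-- `L(𝟙_{⊥M} id^j, s)` converges absolutely for `Re s > j + 1`. [folklore] -/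
theorem LSeriesSummable_ite_coprime_pow (M j : ℕ) {s : ℂ} (hs : (j : ℝ) + 1 < s.re) :
    LSeriesSummable (fun b : ℕ ↦ if b.Coprime M then (b : ℂ) ^ j else 0) s := by
  refine LSeriesSummable_of_le_const_mul_rpow hs ⟨1, fun n _ ↦ ?_⟩
  rw [add_sub_cancel_right, Real.rpow_natCast, one_mul]
  split_ifs
  · rw [norm_pow, Complex.norm_natCast]
  · rw [norm_zero]; positivity

/-- `L(𝟙_{⊥M} μ χ_D id^{r−1}, s)` converges absolutely for `Re s > r` (`r ≥ 1`). [folklore] -/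
theorem LSeriesSummable_ite_coprime_moebius_chiDisc_pow {r : ℕ} (hr : 1 ≤ r) (D : ℤ) (M : ℕ) {s : ℂ}
    (hs : (r : ℝ) < s.re) :
    LSeriesSummable (fun d : ℕ ↦ if d.Coprime M then (μ d : ℂ) * (chiDisc D d : ℂ) * (d : ℂ) ^ (r - 1) else 0) s := by
  have hs' : ((r - 1 : ℕ) : ℝ) + 1 < s.re := by rw [Nat.cast_sub hr, Nat.cast_one, sub_add_cancel]; exact hs
  refine LSeriesSummable_of_le_const_mul_rpow hs' ⟨1, fun n _ ↦ ?_⟩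
  rw [add_sub_cancel_right, Real.rpow_natCast, one_mul]
  split_ifs
  · rw [norm_mul, norm_mul, norm_pow, Complex.norm_natCast, Complex.norm_intCast, Complex.norm_intCast]
    have h1 : |(μ n : ℝ)| ≤ 1 := by exact_mod_cast abs_moebius_le_one
    have h2 : |(chiDisc D n : ℝ)| ≤ 1 := by
      rcases chiDisc_trichotomy D n with h | h | h <;> rw [h] <;> simp
    calc |(μ n : ℝ)| * |(chiDisc D n : ℝ)| * (n : ℝ) ^ (r - 1) ≤ 1 * 1 * (n : ℝ) ^ (r - 1) := by
          gcongr
      _ = (n : ℝ) ^ (r - 1) := by ring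
  · rw [norm_zero]; positivity

/-- `L(𝟙_{⊥M} T_r(D,·), s)` converges absolutely for `Re s > 2r` (`r ≥ 1`; as a convolution of absolutely convergent
series). [cite: Cohen1975, §2 (definition of H(r, N))] -/
theorem LSeriesSummable_ite_coprime_cohenT {r : ℕ} (hr : 1 ≤ r) (D : ℤ) (M : ℕ) {s : ℂ} (hs : 2 * (r : ℝ) < s.re) :
    LSeriesSummable (fun f : ℕ ↦ if f.Coprime M then (cohenT r D f : ℂ) else 0) s := by
  rw [ite_coprime_cohenT_eq_convolution]
  have hr' : (1 : ℝ) ≤ r := by exact_mod_cast hr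
  refine (LSeriesSummable_ite_coprime_moebius_chiDisc_pow hr D M (by linarith)).convolution
    ((LSeriesSummable_ite_coprime_one M (by linarith)).convolution (LSeriesSummable_ite_coprime_pow M _ ?_))
  rw [Nat.cast_sub (by omega), Nat.cast_mul, Nat.cast_two, Nat.cast_one, sub_add_cancel]
  exact hs

/-! ## §5 Lemma B: the `L`-series of `T_r(D, ·)` over the integers prime to `M` -/

/-- **LEMMA B (the `f`-sum of the cusp-constant computation).** For `r ≥ 1`, any discriminant `D`, any `M` and `Re s > 2r`:
`Σ_{f ⊥ M} T_r(D,f) f^{−s} = (Σ_{d ⊥ M} μ(d)χ_D(d)d^{r−1−s}) · (Σ_{a ⊥ M} a^{−s}) · (Σ_{b ⊥ M} b^{2r−1−s})`, i.e.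
`= ζ^{(M)}(s) ζ^{(M)}(s − 2r + 1) / L^{(M)}(s − r + 1, χ_D)` (crux notes `Lines/eisenstein-resource-bdp-line-w5g5-cusp-seed.md` §3,
Lemma B; the last factor is written as the absolutely convergent Dirichlet series of `μ χ_D id^{r−1}` rather than as a quotient).
All three series on the right converge absolutely in `Re s > 2r`. [cite: Cohen1975, §2 (definition of H(r, N))] -/
theorem LSeries_ite_coprime_cohenT {r : ℕ} (hr : 1 ≤ r) (D : ℤ) (M : ℕ) {s : ℂ} (hs : 2 * (r : ℝ) < s.re) :
    LSeries (fun f : ℕ ↦ if f.Coprime M then (cohenT r D f : ℂ) else 0) s =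
      LSeries (fun d : ℕ ↦ if d.Coprime M then (μ d : ℂ) * (chiDisc D d : ℂ) * (d : ℂ) ^ (r - 1) else 0) s *
        (LSeries (fun a : ℕ ↦ if a.Coprime M then (1 : ℂ) else 0) s *
          LSeries (fun b : ℕ ↦ if b.Coprime M then (b : ℂ) ^ (2 * r - 1) else 0) s) := by
  have hr' : (1 : ℝ) ≤ r := by exact_mod_cast hr
  have hA := LSeriesSummable_ite_coprime_moebius_chiDisc_pow hr D M (s := s) (by linarith)
  have hB := LSeriesSummable_ite_coprime_one M (s := s) (by linarith)
  have hC : LSeriesSummable (fun b : ℕ ↦ if b.Coprime M then (b : ℂ) ^ (2 * r - 1) else 0) s := by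
    refine LSeriesSummable_ite_coprime_pow M _ ?_
    rw [Nat.cast_sub (by omega), Nat.cast_mul, Nat.cast_two, Nat.cast_one, sub_add_cancel]
    exact hs
  rw [ite_coprime_cohenT_eq_convolution, LSeries_convolution' hA (hB.convolution hC), LSeries_convolution' hB hC]

end Summit.BirchSwinnertonDyer.BirchSwinnertonDyer.Theorems.PrintCFram.CuspSeed
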